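import Summits.CriticalPhenomena.CardyFormulaZ2.Theorems.CardyIKTransportIKLinearTransportStubCutMarkovLocalTransferPrep
import Summits.CriticalPhenomena.CardyFormulaZ2.Theorems.CardyIKTransportIKLinearTransportStubCutMarkovLocal

/-!
# Stub `stub_CutMarkovLocal` (Loc) — part E₂: (Loc) DOES NOT DEPEND ON THE VERSION — transfer of the
# `local_approx` bound between two cut-Markov versions

Support file (`--supports stmt-CriticalPhenomena-5076`, registered sub-goal `cutMarkov_local_approx_transfer`).

If `Gfin` approximates the depth-`r` sweeps of the heat bath of a cut-Markov version `k₂` on `ballInf v r` off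
`νmix S ⊗ β`-probability `C e^{-cr}`, it approximates those of ANY other cut-Markov version `k` off probability
`max C C_T · (2 + 4/min(c,c_T)) · e^{-(min(c,c_T)/2) r}` (`C_T, c_T` the constants of `isCut_tail`). Proof: the
blank-start sweeps of `k` and `k₂` ending at a row `y₀` give the same middle bits unless there is no cut row among
the `r+1` rows below (`isCut_tail` under the exchanged pattern) or one of the null events of
`crk_sweep_versions_null` occurs: above a cut each dynamics forgets its start (`crk_sweep_agree`) and from the true
start the two dynamics agree (`crk_sweep_agree_versions`). The disagreement event reads (pinned statistic, bits)
only, whose law under `νmix S ⊗ β` is that under `νmix (S ∆ {i,i+1}) ⊗ β` (`ps2_stat_prod_map`, from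
`StripDiagramExchange`); union over the `2r+1` rows of the ball and `ps2_const_bound`.

Consequently (`cutMarkov_local_approx_of_twoSided`, registered): THE REGISTERED (Loc) `stub_CutMarkovLocal` — for
EVERY cut-Markov version — follows from the existence, for every admissible `(S, i)`, of ONE cut-Markov version with
two-sided environment-locality (`∃ k, CutMarkovKernel S i k ∧ ReadsEnv i k`, the strengthening (K₂) of the
neighbouring stub (K) `stub_CutMarkovKernel`), by `cutMarkov_local_approx_of_readsEnv` (`…StubCutMarkovLocal.lean`).
-/

noncomputable section

namespace Summit.CriticalPhenomena.CardyFormulaZ2.Theorems.IKLinearTransport.PinnedDiagramExchange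

open scoped Classical MeasureTheory ENNReal symmDiff
open Set MeasureTheory
open Literature.Probability.Percolation Literature.Probability.LatticeModels

/-! ## The transfer of the `local_approx` bound between versions -/

section Transfer

variable (S : Set ℤ) (i : ℤ) (k k₂ : (Obs × Set (Site 2 × Site 2)) × Obs → Bool × Bool × Bool → ℝ)

/-- The row-`y₀` disagreement of the blank-start sweeps of two versions lies, under the exchanged pattern, in the
union of "no cut row among the `r+1` rows below" and the null events of `crk_sweep_versions_null`. [folklore] -/
theorem crk_rowDiff_subset (hk : CutMarkovKernel S i k) (hk₂ : CutMarkovKernel S i k₂) (y₀ : ℤ) (r : ℕ) :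
    {xu : Obs × Rnd | ¬ ((![i + 1, y₀] ∈ (rowSweep (rowDyn i crkU (crkG S i k)) (r + 1) (y₀ - r) (pinnedStat i xu.1) xu.2
          (eraseMid i xu.1)).1 ↔ ![i + 1, y₀] ∈ (rowSweep (rowDyn i crkU (crkG S i k₂)) (r + 1) (y₀ - r) (pinnedStat i xu.1)
          xu.2 (eraseMid i xu.1)).1) ∧
        (![i, y₀] ∈ (rowSweep (rowDyn i crkU (crkG S i k)) (r + 1) (y₀ - r) (pinnedStat i xu.1) xu.2 (eraseMid i xu.1)).2 ↔
          ![i, y₀] ∈ (rowSweep (rowDyn i crkU (crkG S i k₂)) (r + 1) (y₀ - r) (pinnedStat i xu.1) xu.2 (eraseMid i xu.1)).2) ∧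
        (![i + 1, y₀] ∈ (rowSweep (rowDyn i crkU (crkG S i k)) (r + 1) (y₀ - r) (pinnedStat i xu.1) xu.2 (eraseMid i xu.1)).2 ↔
          ![i + 1, y₀] ∈ (rowSweep (rowDyn i crkU (crkG S i k₂)) (r + 1) (y₀ - r) (pinnedStat i xu.1) xu.2
            (eraseMid i xu.1)).2))} ⊆
    {xu : Obs × Rnd | ∀ c' : ℤ, y₀ - r - 1 ≤ c' → c' ≤ y₀ - 1 → ¬ IsCut i c' (pinnedStat i xu.1)} ∪
    ⋃ j ∈ Finset.range (r + 1), {xu : Obs × Rnd | k (pshift (-((y₀ - r) + j)) (pinnedStat i xu.1),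
        pastMid i 0 (vshift (-((y₀ - r) + j)) (rowSweep (rowDyn i crkU (crkG S i k)) j (y₀ - r) (pinnedStat i xu.1) xu.2 xu.1))) ≠
      k₂ (pshift (-((y₀ - r) + j)) (pinnedStat i xu.1),
        pastMid i 0 (vshift (-((y₀ - r) + j)) (rowSweep (rowDyn i crkU (crkG S i k)) j (y₀ - r) (pinnedStat i xu.1) xu.2 xu.1)))} := by
  rintro ⟨x, u⟩ hbad
  by_contra hnot
  simp only [mem_union, mem_iUnion, Finset.mem_range, mem_setOf_eq, exists_prop, not_or, not_forall, not_not,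
    not_exists, not_and] at hnot
  obtain ⟨⟨c, hc1, hc2, hcut⟩, hN⟩ := hnot
  apply hbad
  set p := pinnedStat i x
  have hpe : eraseMid i x = p.1 := rfl
  -- blank start vs true start for `k`, the two versions from the true start, true vs blank for `k₂`
  have hA := crk_sweep_agree S i k hk c (y₀ - r) (by omega) p hcut u (eraseMid i x) x (r + 1)
  have hB := crk_sweep_agree_versions S i k k₂ hk₂ c (y₀ - r) (by omega) p hcut u x (r + 1)
    (fun j hj _ => hN j hj)
  have hC := crk_sweep_agree S i k₂ hk₂ c (y₀ - r) (by omega) p hcut u x (eraseMid i x) (r + 1)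
  have key := midAgree_trans (midAgree_trans hA hB) hC
  have hrow : y₀ < y₀ - r + ((r + 1 : ℕ) : ℤ) := by push_cast; omega
  exact ⟨(key ![i + 1, y₀] (by simp; omega) (by simpa using hrow)).1 (by simp),
    (key ![i, y₀] (by simp; omega) (by simpa using hrow)).2 (by simp),
    (key ![i + 1, y₀] (by simp; omega) (by simpa using hrow)).2 (by simp)⟩

/-- The row-`y₀` disagreement event of two versions, read from (environment, bits), is measurable. [folklore] -/
theorem crk_rowEvent_measurableSet (hk : CutMarkovKernel S i k) (hk₂ : CutMarkovKernel S i k₂) (y₀ : ℤ) (r : ℕ) :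
    MeasurableSet {pu : (Obs × Set (Site 2 × Site 2)) × Rnd |
      ¬ ((![i + 1, y₀] ∈ (rowSweep (rowDyn i crkU (crkG S i k)) (r + 1) (y₀ - r) pu.1 pu.2 pu.1.1).1 ↔
          ![i + 1, y₀] ∈ (rowSweep (rowDyn i crkU (crkG S i k₂)) (r + 1) (y₀ - r) pu.1 pu.2 pu.1.1).1) ∧
        (![i, y₀] ∈ (rowSweep (rowDyn i crkU (crkG S i k)) (r + 1) (y₀ - r) pu.1 pu.2 pu.1.1).2 ↔
          ![i, y₀] ∈ (rowSweep (rowDyn i crkU (crkG S i k₂)) (r + 1) (y₀ - r) pu.1 pu.2 pu.1.1).2) ∧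
        (![i + 1, y₀] ∈ (rowSweep (rowDyn i crkU (crkG S i k)) (r + 1) (y₀ - r) pu.1 pu.2 pu.1.1).2 ↔
          ![i + 1, y₀] ∈ (rowSweep (rowDyn i crkU (crkG S i k₂)) (r + 1) (y₀ - r) pu.1 pu.2 pu.1.1).2))} := by
  have hT : ∀ kk, CutMarkovKernel S i kk → Measurable fun pu : (Obs × Set (Site 2 × Site 2)) × Rnd =>
      rowSweep (rowDyn i crkU (crkG S i kk)) (r + 1) (y₀ - r) pu.1 pu.2 pu.1.1 := by
    intro kk hkk
    have h0 := ps2_sweep_measurable (Φ := rowDyn i crkU (crkG S i kk)) (T := rowSweep (rowDyn i crkU (crkG S i kk)))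
      (fun _ _ _ _ _ => rfl) (rowDyn_measurable i crkU _ crkU_spec.1 (measurable_crkG S i kk hkk)) (r + 1) (y₀ - r)
    have hg : Measurable fun pu : (Obs × Set (Site 2 × Site 2)) × Rnd => (pu.1, (pu.2, pu.1.1)) :=
      measurable_fst.prodMk (measurable_snd.prodMk (measurable_fst.comp measurable_fst))
    -- compose without expected type (the first-order approximation of the unifier mis-assigns otherwise)
    have h1 := h0.comp hg
    exact h1
  have c1 : ∀ kk, CutMarkovKernel S i kk → ∀ w : Site 2, Measurable fun pu : (Obs × Set (Site 2 × Site 2)) × Rnd =>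
      w ∈ (rowSweep (rowDyn i crkU (crkG S i kk)) (r + 1) (y₀ - r) pu.1 pu.2 pu.1.1).1 := fun kk hkk w =>
    (measurable_set_mem w).comp (measurable_fst.comp (hT kk hkk))
  have c2 : ∀ kk, CutMarkovKernel S i kk → ∀ w : Site 2, Measurable fun pu : (Obs × Set (Site 2 × Site 2)) × Rnd =>
      w ∈ (rowSweep (rowDyn i crkU (crkG S i kk)) (r + 1) (y₀ - r) pu.1 pu.2 pu.1.1).2 := fun kk hkk w =>
    (measurable_set_mem w).comp (measurable_snd.comp (hT kk hkk))
  refine measurableSet_setOf.2 (Measurable.not ?_)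
  exact ((c1 k hk _).iff (c1 k₂ hk₂ _)).and (((c2 k hk _).iff (c2 k₂ hk₂ _)).and ((c2 k hk _).iff (c2 k₂ hk₂ _)))

/-- TRANSFER OF CYLINDER EVENTS over (pinned statistic, bits) between the input and the exchanged pattern
(`ps2_stat_prod_map`). [folklore] -/
theorem crk_stat_prod_transfer (hX : StripDiagramExchange S i) (E : Set ((Obs × Set (Site 2 × Site 2)) × Rnd))
    (hE : MeasurableSet E) :
    ((νmix S).prod β) ((fun xu : Obs × Rnd => (pinnedStat i xu.1, xu.2)) ⁻¹' E) =
      ((νmix (S ∆ {i, i + 1})).prod β) ((fun xu : Obs × Rnd => (pinnedStat i xu.1, xu.2)) ⁻¹' E) := by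
  have hπm : Measurable (fun xu : Obs × Rnd => (pinnedStat i xu.1, xu.2)) :=
    ((measurable_pinnedStat i).comp measurable_fst).prodMk measurable_snd
  rw [← Measure.map_apply hπm hE, ← Measure.map_apply hπm hE]
  exact congrArg (fun m : Measure ((Obs × Set (Site 2 × Site 2)) × Rnd) => m E) (ps2_stat_prod_map S i hX)

/-- THE ROW-`y₀` DISAGREEMENT OF TWO VERSIONS HAS PROBABILITY AT MOST THAT OF "NO CUT ROW BELOW", under the input
pattern `νmix S ⊗ β` (transfer through `StripDiagramExchange`). [folklore] -/
theorem crk_rowDiff_le (hX : StripDiagramExchange S i) (hk : CutMarkovKernel S i k) (hk₂ : CutMarkovKernel S i k₂)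
    (y₀ : ℤ) (r : ℕ) :
    ((νmix S).prod β) {xu : Obs × Rnd | ¬ ((![i + 1, y₀] ∈ (rowSweep (rowDyn i crkU (crkG S i k)) (r + 1) (y₀ - r)
          (pinnedStat i xu.1) xu.2 (eraseMid i xu.1)).1 ↔ ![i + 1, y₀] ∈ (rowSweep (rowDyn i crkU (crkG S i k₂)) (r + 1)
          (y₀ - r) (pinnedStat i xu.1) xu.2 (eraseMid i xu.1)).1) ∧
        (![i, y₀] ∈ (rowSweep (rowDyn i crkU (crkG S i k)) (r + 1) (y₀ - r) (pinnedStat i xu.1) xu.2 (eraseMid i xu.1)).2 ↔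
          ![i, y₀] ∈ (rowSweep (rowDyn i crkU (crkG S i k₂)) (r + 1) (y₀ - r) (pinnedStat i xu.1) xu.2 (eraseMid i xu.1)).2) ∧
        (![i + 1, y₀] ∈ (rowSweep (rowDyn i crkU (crkG S i k)) (r + 1) (y₀ - r) (pinnedStat i xu.1) xu.2 (eraseMid i xu.1)).2 ↔
          ![i + 1, y₀] ∈ (rowSweep (rowDyn i crkU (crkG S i k₂)) (r + 1) (y₀ - r) (pinnedStat i xu.1) xu.2
            (eraseMid i xu.1)).2))} ≤
      (νmix (S ∆ {i, i + 1})) {x | ∀ c' : ℤ, y₀ - r - 1 ≤ c' → c' ≤ y₀ - 1 → ¬ IsCut i c' (pinnedStat i x)} := by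
  set ν' := νmix (S ∆ {i, i + 1}) with hν'
  haveI : IsProbabilityMeasure ν' := isProbabilityMeasure_nuMix _
  haveI : IsProbabilityMeasure β := crk_isProbabilityMeasure_beta
  -- (1) transfer to the exchanged pattern: the event is a cylinder over (pinned statistic, bits)
  have hev : {xu : Obs × Rnd | ¬ ((![i + 1, y₀] ∈ (rowSweep (rowDyn i crkU (crkG S i k)) (r + 1) (y₀ - r)
          (pinnedStat i xu.1) xu.2 (eraseMid i xu.1)).1 ↔ ![i + 1, y₀] ∈ (rowSweep (rowDyn i crkU (crkG S i k₂)) (r + 1)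
          (y₀ - r) (pinnedStat i xu.1) xu.2 (eraseMid i xu.1)).1) ∧
        (![i, y₀] ∈ (rowSweep (rowDyn i crkU (crkG S i k)) (r + 1) (y₀ - r) (pinnedStat i xu.1) xu.2 (eraseMid i xu.1)).2 ↔
          ![i, y₀] ∈ (rowSweep (rowDyn i crkU (crkG S i k₂)) (r + 1) (y₀ - r) (pinnedStat i xu.1) xu.2 (eraseMid i xu.1)).2) ∧
        (![i + 1, y₀] ∈ (rowSweep (rowDyn i crkU (crkG S i k)) (r + 1) (y₀ - r) (pinnedStat i xu.1) xu.2 (eraseMid i xu.1)).2 ↔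
          ![i + 1, y₀] ∈ (rowSweep (rowDyn i crkU (crkG S i k₂)) (r + 1) (y₀ - r) (pinnedStat i xu.1) xu.2
            (eraseMid i xu.1)).2))} =
      (fun xu : Obs × Rnd => (pinnedStat i xu.1, xu.2)) ⁻¹' {pu : (Obs × Set (Site 2 × Site 2)) × Rnd |
      ¬ ((![i + 1, y₀] ∈ (rowSweep (rowDyn i crkU (crkG S i k)) (r + 1) (y₀ - r) pu.1 pu.2 pu.1.1).1 ↔
          ![i + 1, y₀] ∈ (rowSweep (rowDyn i crkU (crkG S i k₂)) (r + 1) (y₀ - r) pu.1 pu.2 pu.1.1).1) ∧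
        (![i, y₀] ∈ (rowSweep (rowDyn i crkU (crkG S i k)) (r + 1) (y₀ - r) pu.1 pu.2 pu.1.1).2 ↔
          ![i, y₀] ∈ (rowSweep (rowDyn i crkU (crkG S i k₂)) (r + 1) (y₀ - r) pu.1 pu.2 pu.1.1).2) ∧
        (![i + 1, y₀] ∈ (rowSweep (rowDyn i crkU (crkG S i k)) (r + 1) (y₀ - r) pu.1 pu.2 pu.1.1).2 ↔
          ![i + 1, y₀] ∈ (rowSweep (rowDyn i crkU (crkG S i k₂)) (r + 1) (y₀ - r) pu.1 pu.2 pu.1.1).2))} := rfl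
  have htrans := crk_stat_prod_transfer S i hX _ (crk_rowEvent_measurableSet S i k k₂ hk hk₂ y₀ r)
  rw [← hev] at htrans
  rw [htrans]
  -- (2) under the exchanged pattern: no cut, or a null event
  refine (measure_mono (crk_rowDiff_subset S i k k₂ hk hk₂ y₀ r)).trans ?_
  refine (measure_union_le _ _).trans ?_
  have hnull : (ν'.prod β) (⋃ j ∈ Finset.range (r + 1), {xu : Obs × Rnd | k (pshift (-((y₀ - r) + j)) (pinnedStat i xu.1),
        pastMid i 0 (vshift (-((y₀ - r) + j)) (rowSweep (rowDyn i crkU (crkG S i k)) j (y₀ - r) (pinnedStat i xu.1) xu.2 xu.1))) ≠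
      k₂ (pshift (-((y₀ - r) + j)) (pinnedStat i xu.1),
        pastMid i 0 (vshift (-((y₀ - r) + j)) (rowSweep (rowDyn i crkU (crkG S i k)) j (y₀ - r) (pinnedStat i xu.1) xu.2 xu.1)))}) = 0 := by
    refine le_antisymm ((measure_biUnion_finset_le _ _).trans ?_) bot_le
    rw [Finset.sum_eq_zero fun j _ => crk_sweep_versions_null S i k k₂ hk hk₂ (y₀ - r) j]
  rw [hnull, add_zero]
  -- (3) the no-cut event is a cylinder over the configurations
  have hcyl : {xu : Obs × Rnd | ∀ c' : ℤ, y₀ - r - 1 ≤ c' → c' ≤ y₀ - 1 → ¬ IsCut i c' (pinnedStat i xu.1)} =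
      {x : Obs | ∀ c' : ℤ, y₀ - r - 1 ≤ c' → c' ≤ y₀ - 1 → ¬ IsCut i c' (pinnedStat i x)} ×ˢ (univ : Set Rnd) := by
    ext xu; simp only [mem_setOf_eq, mem_prod, mem_univ, and_true]
  rw [hcyl, Measure.prod_prod, measure_univ, mul_one]

/-- TRANSFER OF THE `local_approx` BOUND BETWEEN TWO CUT-MARKOV VERSIONS (registered sub-goal
`cutMarkov_local_approx_transfer`): if `Gfin` approximates the depth-`r` sweeps of the heat bath of `k₂` on
`ballInf v r` off probability `C e^{-cr}`, it approximates those of any other cut-Markov version `k` off probability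
`max C C_T · (2 + 4/min(c,c_T)) · e^{-(min(c,c_T)/2) r}`, `C_T, c_T` the constants of `isCut_tail`. [folklore] -/
theorem cutMarkov_local_approx_transfer : ∀ {C c CT cT : ℝ}, 0 < c → 0 ≤ C → 0 < cT → 0 ≤ CT →
    (∀ (S : Set ℤ) (i y : ℤ) (m : ℕ), (νmix S) {x | ∀ c' : ℤ, y - m - 1 ≤ c' → c' ≤ y - 1 → ¬ IsCut i c' (pinnedStat i x)} ≤
      ENNReal.ofReal (CT * Real.exp (-cT * m))) →
    ∀ (S : Set ℤ) (i : ℤ) (k k₂ : (Obs × Set (Site 2 × Site 2)) × Obs → Bool × Bool × Bool → ℝ),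
    StripDiagramExchange S i → CutMarkovKernel S i k → CutMarkovKernel S i k₂ →
    ∀ (v : Site 2) (r : ℕ) (Gfin : Obs → Rnd → Obs),
    ((νmix S).prod β) {xu | ∃ w ∈ ballInf v r,
        (w 0 = i + 1 ∧ ¬ (w ∈ (rowSweep (rowDyn i crkU (crkG S i k₂)) (r + 1) (w 1 - r) (pinnedStat i xu.1) xu.2
            (eraseMid i xu.1)).1 ↔ w ∈ (Gfin xu.1 xu.2).1)) ∨
        ((w 0 = i ∨ w 0 = i + 1) ∧ ¬ (w ∈ (rowSweep (rowDyn i crkU (crkG S i k₂)) (r + 1) (w 1 - r) (pinnedStat i xu.1)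
            xu.2 (eraseMid i xu.1)).2 ↔ w ∈ (Gfin xu.1 xu.2).2))} ≤ ENNReal.ofReal (C * Real.exp (-c * r)) →
    ((νmix S).prod β) {xu | ∃ w ∈ ballInf v r,
        (w 0 = i + 1 ∧ ¬ (w ∈ (rowSweep (rowDyn i crkU (crkG S i k)) (r + 1) (w 1 - r) (pinnedStat i xu.1) xu.2
            (eraseMid i xu.1)).1 ↔ w ∈ (Gfin xu.1 xu.2).1)) ∨
        ((w 0 = i ∨ w 0 = i + 1) ∧ ¬ (w ∈ (rowSweep (rowDyn i crkU (crkG S i k)) (r + 1) (w 1 - r) (pinnedStat i xu.1)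
            xu.2 (eraseMid i xu.1)).2 ↔ w ∈ (Gfin xu.1 xu.2).2))} ≤
      ENNReal.ofReal (max C CT * (2 + 4 / min c cT) * Real.exp (-(min c cT / 2) * r)) := by
  intro C c CT cT hc hC hcT hCT hT S i k k₂ hX hk hk₂ v r Gfin hb
  set P := (νmix S).prod β with hP
  -- names for the sweeps
  set G : ((Obs × Set (Site 2 × Site 2)) × Obs → Bool × Bool × Bool → ℝ) → Site 2 → Obs × Rnd → Obs :=
    fun kk w xu => rowSweep (rowDyn i crkU (crkG S i kk)) (r + 1) (w 1 - r) (pinnedStat i xu.1) xu.2 (eraseMid i xu.1) with hG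
  set Bad : ((Obs × Set (Site 2 × Site 2)) × Obs → Bool × Bool × Bool → ℝ) → Set (Obs × Rnd) := fun kk =>
    {xu | ∃ w ∈ ballInf v r, (w 0 = i + 1 ∧ ¬ (w ∈ (G kk w xu).1 ↔ w ∈ (Gfin xu.1 xu.2).1)) ∨
      ((w 0 = i ∨ w 0 = i + 1) ∧ ¬ (w ∈ (G kk w xu).2 ↔ w ∈ (Gfin xu.1 xu.2).2))} with hBad
  set Row : ℤ → Set (Obs × Rnd) := fun y₀ => {xu | ¬ ((![i + 1, y₀] ∈ (G k ![i + 1, y₀] xu).1 ↔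
      ![i + 1, y₀] ∈ (G k₂ ![i + 1, y₀] xu).1) ∧ (![i, y₀] ∈ (G k ![i, y₀] xu).2 ↔ ![i, y₀] ∈ (G k₂ ![i, y₀] xu).2) ∧
      (![i + 1, y₀] ∈ (G k ![i + 1, y₀] xu).2 ↔ ![i + 1, y₀] ∈ (G k₂ ![i + 1, y₀] xu).2))} with hRow
  change P (Bad k) ≤ _
  change P (Bad k₂) ≤ _ at hb
  -- Bad k ⊆ Bad k₂ ∪ ⋃ rows
  have hincl : Bad k ⊆ Bad k₂ ∪ ⋃ y₀ ∈ Finset.Icc (v 1 - r) (v 1 + r), Row y₀ := by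
    rintro xu ⟨w, hw, hdis⟩
    by_cases h2 : xu ∈ Bad k₂
    · exact Or.inl h2
    · right
      simp only [mem_iUnion, Finset.mem_Icc, exists_prop]
      have hy : v 1 - r ≤ w 1 ∧ w 1 ≤ v 1 + r := by
        have := hw.2; constructor <;> linarith [(abs_le.1 this).1, (abs_le.1 this).2]
      refine ⟨w 1, hy, fun hagree => h2 ⟨w, hw, ?_⟩⟩
      rcases hdis with ⟨h0, hne⟩ | ⟨h0, hne⟩
      · have hw' : w = ![i + 1, w 1] := by conv_lhs => rw [ps2_eq_vec2 w, h0]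
        refine Or.inl ⟨h0, fun h' => hne ?_⟩
        have e1 := hagree.1
        rw [← hw'] at e1
        exact e1.trans h'
      · rcases h0 with h0 | h0
        · have hw' : w = ![i, w 1] := by conv_lhs => rw [ps2_eq_vec2 w, h0]
          refine Or.inr ⟨Or.inl h0, fun h' => hne ?_⟩
          have e1 := hagree.2.1
          rw [← hw'] at e1
          exact e1.trans h'
        · have hw' : w = ![i + 1, w 1] := by conv_lhs => rw [ps2_eq_vec2 w, h0]
          refine Or.inr ⟨Or.inr h0, fun h' => hne ?_⟩
          have e1 := hagree.2.2
          rw [← hw'] at e1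
          exact e1.trans h'
  -- the row events
  have hrow : ∀ y₀ : ℤ, P (Row y₀) ≤ ENNReal.ofReal (CT * Real.exp (-cT * r)) := by
    intro y₀
    have h1 := crk_rowDiff_le S i k k₂ hX hk hk₂ y₀ r
    have e0 : (![i + 1, y₀] : Site 2) 1 - (r : ℤ) = y₀ - r := rfl
    have e1 : (![i, y₀] : Site 2) 1 - (r : ℤ) = y₀ - r := rfl
    simp only [hRow, hG, e0, e1]
    exact h1.trans (hT _ i y₀ r)
  -- the bound
  have hM0 : 0 ≤ max C CT := hC.trans (le_max_left _ _)
  have hm : 0 < min c cT := lt_min hc hcT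
  have t1 : ENNReal.ofReal (C * Real.exp (-c * r)) ≤ ENNReal.ofReal (max C CT * Real.exp (-(min c cT) * r)) :=
    crk_expBound_mono (le_max_left _ _) hM0 (min_le_left _ _) r (Nat.cast_nonneg r)
  have t2 : ENNReal.ofReal (CT * Real.exp (-cT * r)) ≤ ENNReal.ofReal (max C CT * Real.exp (-(min c cT) * r)) :=
    crk_expBound_mono (le_max_right _ _) hM0 (min_le_right _ _) r (Nat.cast_nonneg r)
  have hcard : (Finset.Icc (v 1 - r) (v 1 + r)).card = 2 * r + 1 := by rw [Int.card_Icc]; omega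
  calc P (Bad k) ≤ P (Bad k₂ ∪ ⋃ y₀ ∈ Finset.Icc (v 1 - r) (v 1 + r), Row y₀) := measure_mono hincl
    _ ≤ P (Bad k₂) + P (⋃ y₀ ∈ Finset.Icc (v 1 - r) (v 1 + r), Row y₀) := measure_union_le _ _
    _ ≤ P (Bad k₂) + ∑ y₀ ∈ Finset.Icc (v 1 - r) (v 1 + r), P (Row y₀) :=
        add_le_add le_rfl (measure_biUnion_finset_le _ _)
    _ ≤ ENNReal.ofReal (max C CT * Real.exp (-(min c cT) * r)) +
          ∑ y₀ ∈ Finset.Icc (v 1 - r) (v 1 + r), ENNReal.ofReal (max C CT * Real.exp (-(min c cT) * r)) :=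
        add_le_add (hb.trans t1) (Finset.sum_le_sum fun y₀ _ => (hrow y₀).trans t2)
    _ = ((2 * r + 2 : ℕ) : ℝ≥0∞) * ENNReal.ofReal (max C CT * Real.exp (-(min c cT) * r)) := by
        rw [Finset.sum_const, hcard, nsmul_eq_mul]; push_cast; ring
    _ = ENNReal.ofReal ((2 * r + 2 : ℕ) * (max C CT * Real.exp (-(min c cT) * r))) := by
        rw [ENNReal.ofReal_mul (p := ((2 * r + 2 : ℕ) : ℝ)) (by positivity), ENNReal.ofReal_natCast]
    _ ≤ ENNReal.ofReal (max C CT * (2 + 4 / min c cT) * Real.exp (-(min c cT / 2) * r)) := by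
        refine ENNReal.ofReal_le_ofReal ?_
        have := ps2_const_bound hm hM0 r
        push_cast at this ⊢
        exact this

end Transfer

/-! ## (Loc) from a two-sided cut-Markov version -/

/-- (Loc) FOR EVERY CUT-MARKOV VERSION, FROM ONE TWO-SIDED ONE (registered sub-goal
`cutMarkov_local_approx_of_twoSided`): if every admissible `(S, i)` with strip diagram exchange admits a cut-Markov
version of the conditional middle-row law with two-sided environment-locality (`CutMarkovKernel S i k ∧ ReadsEnv i k`),
then the registered (Loc) `stub_CutMarkovLocal` holds verbatim: the `2r`-local approximants of the depth-`r` sweeps of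
the heat bath of EVERY cut-Markov version, off probability `C e^{-cr}` with absolute constants. [folklore] -/
theorem cutMarkov_local_approx_of_twoSided :
    (∀ (S : Set ℤ) (i : ℤ), (i ∈ S ↔ i + 1 ∉ S) → StripDiagramExchange S i →
      ∃ k : (Obs × Set (Site 2 × Site 2)) × Obs → Bool × Bool × Bool → ℝ, CutMarkovKernel S i k ∧ ReadsEnv i k) →
    ∃ C c : ℝ, 0 < c ∧ ∀ (S : Set ℤ) (i : ℤ) (k : (Obs × Set (Site 2 × Site 2)) × Obs → Bool × Bool × Bool → ℝ),
      (i ∈ S ↔ i + 1 ∉ S) → StripDiagramExchange S i → CutMarkovKernel S i k →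
      ∀ (v : Site 2) (r : ℕ), ∃ Gfin : Obs → Rnd → Obs,
        (∀ (x x' : Obs) (u u' : Rnd),
          (∀ w ∈ ballInf v (2 * r), (w ∈ x.1 ↔ w ∈ x'.1) ∧ (w ∈ x.2 ↔ w ∈ x'.2) ∧
            ∀ k : ℕ, ((w, k) ∈ u ↔ (w, k) ∈ u')) →
          ∀ w ∈ ballInf v r, (w ∈ (Gfin x u).1 ↔ w ∈ (Gfin x' u').1) ∧ (w ∈ (Gfin x u).2 ↔ w ∈ (Gfin x' u').2)) ∧
        ((νmix S).prod β) {xu | ∃ w ∈ ballInf v r,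
          (w 0 = i + 1 ∧ ¬ (w ∈ (rowSweep (rowDyn i crkU (crkG S i k)) (r + 1) (w 1 - r) (pinnedStat i xu.1) xu.2
              (eraseMid i xu.1)).1 ↔ w ∈ (Gfin xu.1 xu.2).1)) ∨
          ((w 0 = i ∨ w 0 = i + 1) ∧ ¬ (w ∈ (rowSweep (rowDyn i crkU (crkG S i k)) (r + 1) (w 1 - r) (pinnedStat i xu.1)
              xu.2 (eraseMid i xu.1)).2 ↔ w ∈ (Gfin xu.1 xu.2).2))} ≤ ENNReal.ofReal (C * Real.exp (-c * r)) := by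
  intro hK2
  obtain ⟨C, c, hc, hL⟩ := cutMarkov_local_approx_of_readsEnv
  obtain ⟨CT, cT, hcT, hCT, hT⟩ := isCut_tail
  refine ⟨max (max C 0) CT * (2 + 4 / min c cT), min c cT / 2, div_pos (lt_min hc hcT) two_pos,
    fun S i k hSi hX hk v r => ?_⟩
  obtain ⟨k₂, hk₂, hke₂⟩ := hK2 S i hSi hX
  obtain ⟨Gfin, hloc, hb⟩ := hL S i k₂ hSi hX hk₂ hke₂ v r
  refine ⟨Gfin, hloc, ?_⟩
  have hb' := hb.trans (crk_expBound_mono (le_max_left C 0) (le_max_right C 0) le_rfl r (Nat.cast_nonneg r))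
  exact cutMarkov_local_approx_transfer hc (le_max_right C 0) hcT hCT hT S i k k₂ hX hk hk₂ v r Gfin hb'

end Summit.CriticalPhenomena.CardyFormulaZ2.Theorems.IKLinearTransport.PinnedDiagramExchange
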